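import Mathlib.Analysis.Distribution.AEEqOfIntegralContDiff
import Mathlib.Analysis.SpecialFunctions.ExpDeriv
import Mathlib.MeasureTheory.Integral.IntervalIntegral.FundThmCalculus
import Mathlib.MeasureTheory.Integral.IntervalIntegral.IntegrationByParts
import Mathlib.Analysis.Calculus.ContDiff.Deriv
import Literature.Analysis.FunctionSpaces.DuBoisReymondAE
import HarnessLib

/-!
# Weak solutions of the scalar linear ODE `f' = -λ f` with initial datum are exponentials

Analysis/FunctionSpaces support file. The one-dimensional "du Bois-Reymond with an initial
condition" step by which tested (distributional) evolution identities are integrated mode by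
mode — e.g. the Fourier coefficients of a weak solution of the heat equation on the torus, tested
against `ρ(t) e_k(x)`, satisfy `∫₀ᵀ (ρ' - λρ) f̂ₖ dt + ρ(0) ĝₖ = 0` for all smooth `ρ` vanishing
near `T`, whence `f̂ₖ(t) = e^{-λt} ĝₖ` (Evans, *PDE*, §7.1.2 b, motivation of the weak
formulation, and §2.3.1; Temam, *Navier–Stokes Equations*, Ch. III, Lemma 1.1: a distribution on
`(0,T)` with values in a Banach space whose derivative is given is determined up to a constant).

* (uses `Literature.Analysis.FunctionSpaces.contDiff_primitive` of `DuBoisReymondAE`: primitives of smooth functions are smooth;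
  that file's `ae_eq_add_setIntegral_of_forall_test` is the real-valued integral-equation form
  of the same du Bois-Reymond-with-datum principle, with a general right-hand side.)
* `Literature.Analysis.FunctionSpaces.ae_eq_exp_smul_of_forall_integral_deriv_sub` — **the lemma**: if `f ∈ L¹(0,T; F)` and
  `∫_{(0,T)} (ρ' - λρ) • f + ρ(0) • c = 0` for every smooth real `ρ` vanishing on some
  `[T', ∞)`, `T' < T`, then `f(t) = e^{-λt} • c` for a.e. `t ∈ (0,T)`. Proof by duality: for a
  smooth `ζ` compactly supported in `(0,T)` the function `ρ(t) = -e^{λt} ∫ₜᵀ e^{-λs} ζ(s) ds`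
  is an admissible test with `ρ' - λρ = ζ`, `ρ(0) = -∫₀ᵀ e^{-λs}ζ`, so
  `∫ ζ • (f - e^{-λ·} • c) = 0`, and Mathlib's
  `IsOpen.ae_eq_zero_of_integral_contDiff_smul_eq_zero` concludes.

## Mathlib search

Mathlib (this pin) has the distributional uniqueness lemma
`IsOpen.ae_eq_zero_of_integral_contDiff_smul_eq_zero` and the calculus of `Real.exp`, interval
integrals and their derivatives (`intervalIntegral.integral_hasDerivAt_right`); no statement
about weak/distributional solutions of linear ODEs (searched `deriv` + `ae_eq` + `exp`,
`gronwall` (only differential inequalities for differentiable functions)).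

## References

* L. C. Evans, *Partial Differential Equations*, 2nd ed. (2010), §2.3.1, §7.1.2.
* R. Temam, *Navier–Stokes Equations* (3rd ed., 1984), Ch. III, §1.1, Lemma 1.1.
-/

noncomputable section

open MeasureTheory Set Filter Topology intervalIntegral
open scoped ContDiff

namespace Literature.Analysis.FunctionSpaces

variable {F : Type*} [NormedAddCommGroup F] [NormedSpace ℝ F] [CompleteSpace F]

/-- The dual test function of the duality proof: for `ζ` smooth,
`ρ(t) = -e^{λt} ∫ₜᵀ e^{-λs} ζ(s) ds` is smooth with `ρ' = λρ + ζ`. [folklore] -/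
theorem hasDerivAt_dualTest {ζ : ℝ → ℝ} (hζ : ContDiff ℝ ∞ ζ) (lam T t : ℝ) :
    HasDerivAt (fun t => -Real.exp (lam * t) * ∫ s in t..T, Real.exp (-(lam * s)) * ζ s)
      (lam * (-Real.exp (lam * t) * ∫ s in t..T, Real.exp (-(lam * s)) * ζ s) + ζ t) t := by
  have hg : Continuous fun s => Real.exp (-(lam * s)) * ζ s :=
    (Real.continuous_exp.comp (continuous_const.mul continuous_id).neg).mul hζ.continuous
  -- derivative of `t ↦ ∫ s in t..T, g s` is `-g t`
  have h1 : HasDerivAt (fun t => ∫ s in t..T, Real.exp (-(lam * s)) * ζ s)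
      (-(Real.exp (-(lam * t)) * ζ t)) t := by
    have h := (hg.integral_hasStrictDerivAt T t).hasDerivAt
    have heq : (fun t => ∫ s in t..T, Real.exp (-(lam * s)) * ζ s) =
        fun t => -∫ s in T..t, Real.exp (-(lam * s)) * ζ s := by
      funext t; rw [integral_symm]
    rw [heq]
    exact h.neg
  have h2 : HasDerivAt (fun t => -Real.exp (lam * t)) (-(Real.exp (lam * t) * lam)) t := by
    have h := ((hasDerivAt_id t).const_mul lam).exp
    simp only [mul_one] at h
    exact h.neg
  have h3 : HasDerivAt (fun t => -Real.exp (lam * t) * ∫ s in t..T, Real.exp (-(lam * s)) * ζ s)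
      (-(Real.exp (lam * t) * lam) * (∫ s in t..T, Real.exp (-(lam * s)) * ζ s) +
        -Real.exp (lam * t) * -(Real.exp (-(lam * t)) * ζ t)) t := h2.mul h1
  refine h3.congr_deriv ?_
  have he : Real.exp (lam * t) * Real.exp (-(lam * t)) = 1 := by
    rw [← Real.exp_add, add_neg_cancel, Real.exp_zero]
  have : -Real.exp (lam * t) * -(Real.exp (-(lam * t)) * ζ t) =
      Real.exp (lam * t) * Real.exp (-(lam * t)) * ζ t := by ring
  rw [this, he]
  ring

/-- Smoothness of the dual test function. [folklore] -/
theorem contDiff_dualTest {ζ : ℝ → ℝ} (hζ : ContDiff ℝ ∞ ζ) (lam T : ℝ) :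
    ContDiff ℝ ∞ fun t => -Real.exp (lam * t) * ∫ s in t..T, Real.exp (-(lam * s)) * ζ s := by
  have hg : ContDiff ℝ ∞ fun s => Real.exp (-(lam * s)) * ζ s :=
    (Real.contDiff_exp.comp (contDiff_const.mul contDiff_id).neg).mul hζ
  have hprim : ContDiff ℝ ∞ fun t => ∫ s in t..T, Real.exp (-(lam * s)) * ζ s := by
    have h := contDiff_primitive hg T
    have heq : (fun t => ∫ s in t..T, Real.exp (-(lam * s)) * ζ s) =
        fun t => -∫ s in T..t, Real.exp (-(lam * s)) * ζ s := by
      funext t; rw [integral_symm]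
    rw [heq]
    exact h.neg
  exact (Real.contDiff_exp.comp (contDiff_const.mul contDiff_id)).neg.mul hprim

/-- **Weak solutions of `f' = -λ f` with initial datum.** Let `f ∈ L¹((0,T); F)`, `λ ∈ ℝ`,
`c ∈ F`, and suppose that for every smooth `ρ : ℝ → ℝ` vanishing on some `[T', ∞)` with
`T' < T`,
`∫_{(0,T)} (ρ'(t) - λ ρ(t)) • f(t) dt + ρ(0) • c = 0`
(the identity obtained by testing `∂ₜ f = -λ f`, `f(0) = c` against `ρ`). Then
`f(t) = e^{-λt} • c` for a.e. `t ∈ (0,T)` (Evans, §7.1.2; Temam, Ch. III, Lemma 1.1). Proof by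
duality with the explicit solution `ρ = -e^{λt}∫ₜᵀ e^{-λs}ζ` of `ρ' - λρ = ζ`, `ρ = 0` near `T`,
for `ζ ∈ C_c^∞((0,T))`, and `IsOpen.ae_eq_zero_of_integral_contDiff_smul_eq_zero`. [folklore] -/
theorem ae_eq_exp_smul_of_forall_integral_deriv_sub {T : ℝ} {f : ℝ → F}
    (hf : IntegrableOn f (Ioo 0 T) volume) (lam : ℝ) (c : F)
    (h : ∀ ρ : ℝ → ℝ, ContDiff ℝ ∞ ρ → (∃ T' < T, ∀ t, T' ≤ t → ρ t = 0) →
      (∫ t in Ioo 0 T, (deriv ρ t - lam * ρ t) • f t) + ρ 0 • c = 0) :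
    ∀ᵐ t ∂(volume.restrict (Ioo 0 T)), f t = Real.exp (-(lam * t)) • c := by
  rcases le_or_gt T 0 with hT | hT
  · rw [Ioo_eq_empty (not_lt.2 hT), Measure.restrict_empty]
    rw [ae_zero]; exact eventually_bot
  -- the difference `g = f - e^{-λ·} • c` is locally integrable on `(0,T)`
  set g : ℝ → F := fun t => f t - Real.exp (-(lam * t)) • c with hg_def
  have hec : Continuous fun t : ℝ => Real.exp (-(lam * t)) • c :=
    (Real.continuous_exp.comp (continuous_const.mul continuous_id).neg).smul continuous_const
  have hgi : IntegrableOn g (Ioo 0 T) volume :=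
    hf.sub (hec.integrableOn_Icc.mono_set Ioo_subset_Icc_self)
  have hmain : ∀ᵐ t ∂(volume : Measure ℝ), t ∈ Ioo 0 T → g t = 0 := by
    refine isOpen_Ioo.ae_eq_zero_of_integral_contDiff_smul_eq_zero hgi.locallyIntegrableOn
      fun ζ hζ hζc hζs => ?_
    -- the support of `ζ` stays away from `T` and from `0`
    obtain ⟨T', hT'T, hT'⟩ : ∃ T' < T, ∀ t, T' ≤ t → ζ t = 0 := by
      by_cases hne : (tsupport ζ).Nonempty
      · have hK : IsCompact (tsupport ζ) := hζc
        obtain ⟨m, hm, hmax⟩ := hK.exists_isMaxOn hne continuous_id.continuousOn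
        have hmT : m < T := (hζs hm).2
        refine ⟨(m + T) / 2, by linarith, fun t ht => ?_⟩
        have hnot : t ∉ tsupport ζ := fun htm => by
          have hle : t ≤ m := hmax htm
          linarith
        exact image_eq_zero_of_notMem_tsupport hnot
      · rw [not_nonempty_iff_eq_empty] at hne
        refine ⟨T - 1, by linarith, fun t _ => ?_⟩
        exact image_eq_zero_of_notMem_tsupport (by simp [hne])
    have hζ0 : ∀ t, t ≤ 0 → ζ t = 0 := fun t ht =>
      image_eq_zero_of_notMem_tsupport fun htm => by linarith [(hζs htm).1]
    -- the dual test function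
    set ρ : ℝ → ℝ := fun t => -Real.exp (lam * t) * ∫ s in t..T, Real.exp (-(lam * s)) * ζ s
      with hρ_def
    have hρs : ContDiff ℝ ∞ ρ := contDiff_dualTest hζ lam T
    have hρd : ∀ t, deriv ρ t - lam * ρ t = ζ t := fun t => by
      rw [(hasDerivAt_dualTest hζ lam T t).deriv]
      simp only [hρ_def]
      ring
    have hker : ∀ t, T' ≤ t → (∫ s in t..T, Real.exp (-(lam * s)) * ζ s) = 0 := by
      intro t ht
      refine integral_zero_ae (Eventually.of_forall fun s hs => ?_)
      -- `s` between `t` and `T` lies in `[T', ∞)` in either order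
      have hs' : T' ≤ s := by
        rcases le_total t T with htT | hTt
        · rw [uIoc_of_le htT] at hs; linarith [hs.1]
        · rw [uIoc_of_ge hTt] at hs; linarith [hs.1]
      simp [hT' s hs']
    have hρ0 : ∀ t, T' ≤ t → ρ t = 0 := fun t ht => by
      simp only [hρ_def, hker t ht, mul_zero]
    have hid := h ρ hρs ⟨T', hT'T, hρ0⟩
    simp_rw [hρd] at hid
    -- `ρ 0 = -∫₀ᵀ e^{-λs} ζ(s) ds`
    have hρzero : ρ 0 = -∫ s in (0 : ℝ)..T, Real.exp (-(lam * s)) * ζ s := by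
      simp [hρ_def]
    -- rewrite the whole-line integral as the integral over `(0,T)`
    have hsupp : ∀ t, t ∉ Ioo 0 T → ζ t • g t = 0 := fun t ht => by
      have : ζ t = 0 := image_eq_zero_of_notMem_tsupport fun htm => ht (hζs htm)
      rw [this, zero_smul]
    rw [← setIntegral_eq_integral_of_forall_compl_eq_zero (s := Ioo 0 T) (fun t ht => hsupp t ht)]
    have hi1 : Integrable (fun t => ζ t • f t) (volume.restrict (Ioo 0 T)) := by
      obtain ⟨C, hC⟩ := hζc.exists_bound_of_continuous hζ.continuous
      exact hf.bdd_smul C hζ.continuous.aestronglyMeasurable (Eventually.of_forall hC)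
    have hi2 : Integrable (fun t => ζ t • (Real.exp (-(lam * t)) • c))
        (volume.restrict (Ioo 0 T)) := by
      have hcont : Continuous fun t => ζ t • (Real.exp (-(lam * t)) • c) :=
        hζ.continuous.smul hec
      exact hcont.integrableOn_Icc.mono_set Ioo_subset_Icc_self
    have hsplit : ∫ t in Ioo 0 T, ζ t • g t =
        (∫ t in Ioo 0 T, ζ t • f t) - ∫ t in Ioo 0 T, ζ t • (Real.exp (-(lam * t)) • c) := by
      simp only [hg_def, smul_sub]
      exact integral_sub hi1 hi2
    have hI2 : ∫ t in Ioo 0 T, ζ t • (Real.exp (-(lam * t)) • c) =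
        (∫ s in (0 : ℝ)..T, Real.exp (-(lam * s)) * ζ s) • c := by
      simp_rw [smul_smul]
      rw [_root_.integral_smul_const, intervalIntegral.integral_of_le hT.le, integral_Ioc_eq_integral_Ioo]
      congr 1
      refine integral_congr_ae (Eventually.of_forall fun t => ?_)
      show ζ t * Real.exp (-(lam * t)) = Real.exp (-(lam * t)) * ζ t
      ring
    have hI1 : ∫ t in Ioo 0 T, ζ t • f t = (∫ s in (0 : ℝ)..T, Real.exp (-(lam * s)) * ζ s) • c := by
      rw [hρzero, neg_smul] at hid
      exact add_neg_eq_zero.1 hid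
    rw [hsplit, hI1, hI2, sub_self]
  -- conclusion on `(0,T)`
  rw [ae_restrict_iff' measurableSet_Ioo]
  filter_upwards [hmain] with t ht htmem
  have := ht htmem
  simp only [hg_def, sub_eq_zero] at this
  exact this

end Literature.Analysis.FunctionSpaces

end
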